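import Summits.ABC.ABC.Theses.IneffectiveSubspace
import Summits.ABC.ABC.Theorems.IneffectiveSubspaceUniformSadicTowerFourGaussianNormalForm
import Summits.ABC.ABC.Theorems.IneffectiveSubspaceUniformSadicTowerFourHarmonicThue
import Literature.NumberTheory.DiophantineGeometry.SimplestQuarticThue

/-!
# The settled half of the Pell-square cell: the unit slice and Ljunggren's `239² + 1 = 2·13⁴` (stmt-ABC-14937)

Third calibration file of line `SketchIdeator4` (card
`Cruxes/UniformSadicTowerFour/Ideas/gaussian-thue-pell-square.md` §Why it bites (a)) for crux #2
`UniformSadicTowerFour` of route `IneffectiveSubspace`.  The cell `1 + t² = m·n⁴` of the `K = 0` face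
is, by the landed `ℤ[i]` normal form (`GaussianNormalForm.thueSolution_of_cell`), the set of solutions of
the harmonic quartic Thue equations `Im(μ·ν⁴) = 1`, `N(μ) = m`, `N(ν) = n`.  On the slice
`μ = C ± i` these are the SIMPLEST QUARTIC Thue equations `P_{4|C|}(e, ±f) = ±1`
(`HarmonicThue.im_pow_four_mul`; `P_s(X,Y) = X⁴ − sX³Y − 6X²Y² + sXY³ + Y⁴`), completely solved by
Lettl–Pethő 1995 / Chen–Voutier 1997 — vendored as the named fact
`Literature.NumberTheory.DiophantineGeometry.SimplestQuarticThueSolutions` (Chen–Voutier Thm 3).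
CONDITIONAL on that named fact (hypothesis `h`), this file proves:

* `sq_add_sq_eq_one_of_simplestQuartic` — for `|s| ≥ 5`, `P_s(x,y) = ±1 ⟹ x² + y² = 1`;
  `sq_add_sq_of_simplestQuartic_four` — for `|s| = 4`, `P_s(x,y) = ±1 ⟹ x² + y² ∈ {1, 13}`.
* `norm_eq_one_of_unit_slice` — **the unit slice is empty**: if `Im((C ± i)·ν⁴) = ±1` with `|C| ≥ 2`
  then `N(ν) = 1`; i.e. on the slice `μ = C ± i`, `m = C² + 1 ≥ 5`, the cell has no point with `n > 1`.
* `ljunggren_of_simplestQuarticThue` — **Ljunggren's theorem from Chen–Voutier Thm 3**: the only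
  `n` with `1 + t² = 2·n⁴` are `n = 1` and `n = 13` (every `μ` of norm `2` is `±1 ± i`, the slice
  `|C| = 1`, parameter `s = 4`; the solution `(3, ∓2)` is `(3+2i)⁴(1+i) = −239 + i`).
* `cell_point_unique_of_negPellQuartic` — per `m ≥ 3` the cell has at most one point (restating the
  named fact `NegPellQuarticAtMostOne`, Chen–Voutier Thm 4, in cell coordinates).

So the COUNT/STRUCTURE half of the cell is a theorem modulo two refereed named facts; the SIZE half
(`W₄`, `QuarticRootWall.quarticRootWall_of_uniformSadicTowerFour`) is the open atom.  No composition
concluding the crux is claimed (see `Lines/SketchIdeator4.dead.md` in the crux directory).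
-/

-- `Summit.<Summit>.<Problem>` is the mandated summit-side namespace (CONVENTIONS §2); for the
-- single-conjunct summit `ABC` the two coincide, so the duplicate `ABC.ABC` is deliberate.
set_option linter.dupNamespace false

namespace Summit.ABC.ABC.Theorems.UniformSadicTowerFour.QuarticRootWall

open Summit.ABC.ABC.Theses.IneffectiveSubspace
open Summit.ABC.ABC.Theorems
open Literature.NumberTheory.DiophantineGeometry

/-! ## Bookkeeping on the simplest quartic form -/

/-- `P_{−s}(x, y) = P_s(x, −y)`. [folklore] -/
theorem simplestQuarticForm_neg (s x y : ℤ) :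
    simplestQuarticForm (-s) x y = simplestQuarticForm s x (-y) := by
  simp only [simplestQuarticForm]; ring

/-- **Trivial solutions only, `|s| ≥ 5`** (from Chen–Voutier Thm 3, clause `t ≥ 5`, applied to
`P_{|s|}(x, ±y)`): `P_s(x,y) = ±1 ⟹ x² + y² = 1`. [folklore] -/
theorem sq_add_sq_eq_one_of_simplestQuartic (h : SimplestQuarticThueSolutions) {s x y : ℤ}
    (hs : 5 ≤ |s|) (hP : simplestQuarticForm s x y = 1 ∨ simplestQuarticForm s x y = -1) :
    x ^ 2 + y ^ 2 = 1 := by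
  -- reduce to a positive parameter `s' = |s| ≥ 5` and the point `(x, y')`, `y' = ±y`
  obtain ⟨s', y', hs', hP', hy⟩ : ∃ s' y' : ℤ, 5 ≤ s' ∧
      (simplestQuarticForm s' x y' = 1 ∨ simplestQuarticForm s' x y' = -1) ∧ y' ^ 2 = y ^ 2 := by
    rcases le_or_gt 0 s with h0 | h0
    · exact ⟨s, y, by rwa [abs_of_nonneg h0] at hs, hP, rfl⟩
    · refine ⟨-s, -y, by rwa [abs_of_neg h0] at hs, ?_, by ring⟩
      rwa [simplestQuarticForm_neg, neg_neg]
  rw [← hy]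
  rcases h s' (by linarith) (by linarith) x y' hP' with ⟨h1, -⟩ | ⟨h4, -⟩ | ⟨-, hmem⟩
  · omega
  · omega
  · simp only [Set.mem_insert_iff, Set.mem_singleton_iff, Prod.mk.injEq] at hmem
    rcases hmem with ⟨rfl, rfl⟩ | ⟨rfl, rfl⟩ | ⟨rfl, rfl⟩ | ⟨rfl, rfl⟩ <;> norm_num

/-- **The `s = ±4` equations** (Chen–Voutier Thm 3, clause `t = 4`): `P_{±4}(x,y) = ±1 ⟹
x² + y² ∈ {1, 13}` (the eight solutions `(−3,2), (−2,3), (−1,0), (0,±1), (1,0), (2,3), (3,−2)` of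
`P_4 = ±1`). [folklore] -/
theorem sq_add_sq_of_simplestQuartic_four (h : SimplestQuarticThueSolutions) {s x y : ℤ}
    (hs : s = 4 ∨ s = -4) (hP : simplestQuarticForm s x y = 1 ∨ simplestQuarticForm s x y = -1) :
    x ^ 2 + y ^ 2 = 1 ∨ x ^ 2 + y ^ 2 = 13 := by
  obtain ⟨y', hP', hy⟩ : ∃ y' : ℤ,
      (simplestQuarticForm 4 x y' = 1 ∨ simplestQuarticForm 4 x y' = -1) ∧ y' ^ 2 = y ^ 2 := by
    rcases hs with rfl | rfl
    · exact ⟨y, hP, rfl⟩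
    · refine ⟨-y, ?_, by ring⟩
      rwa [show (-4 : ℤ) = -(4 : ℤ) by norm_num, simplestQuarticForm_neg] at hP
  rw [← hy]
  rcases h 4 (by norm_num) (by norm_num) x y' hP' with ⟨h1, -⟩ | ⟨-, hmem⟩ | ⟨h5, -⟩
  · omega
  · simp only [Set.mem_insert_iff, Set.mem_singleton_iff, Prod.mk.injEq] at hmem
    rcases hmem with ⟨rfl, rfl⟩ | ⟨rfl, rfl⟩ | ⟨rfl, rfl⟩ | ⟨rfl, rfl⟩ | ⟨rfl, rfl⟩ | ⟨rfl, rfl⟩ |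
      ⟨rfl, rfl⟩ | ⟨rfl, rfl⟩ <;> norm_num
  · omega

/-! ## The slice `μ = C ± i` of the cell -/

/-- **The harmonic form on the slice `D = ±1` is a simplest quartic**: for `μ = C + Di` with `D = ±1`,
`Im(ν⁴·μ) = D · P_{−4CD}(e, f)` (`ν = e + fi`); concretely `Im(ν⁴(C + i)) = P_{−4C}(e,f)` and
`Im(ν⁴(C − i)) = −P_{4C}(e,f)`. [folklore] -/
theorem im_pow_four_mul_slice (e f C : ℤ) :
    ((⟨e, f⟩ : GaussianInt) ^ 4 * (⟨C, 1⟩ : GaussianInt)).im = simplestQuarticForm (-4 * C) e f ∧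
    ((⟨e, f⟩ : GaussianInt) ^ 4 * (⟨C, -1⟩ : GaussianInt)).im = -simplestQuarticForm (4 * C) e f := by
  rw [im_pow_four_mul, im_pow_four_mul]
  simp only [simplestQuarticForm]
  constructor <;> ring

/-- **The unit slice of the cell is empty beyond `|C| = 1`** (conditional on Chen–Voutier Thm 3): if
`Im(μ·ν⁴) = ±1` with `μ = C ± i`, `|C| ≥ 2`, then `N(ν) = 1`.  In cell language: for `t + i = μ·ν⁴`
with `μ = C ± i` (so `m = C² + 1`) and `|C| ≥ 2` the modulus is `n = N(ν) = 1` — the `s = 4|C| ≥ 8`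
simplest quartic Thue equations have only trivial solutions. [folklore] -/
theorem norm_eq_one_of_unit_slice (h : SimplestQuarticThueSolutions) {C D : ℤ} (hD : D = 1 ∨ D = -1)
    (hC : 2 ≤ |C|) (ν : GaussianInt)
    (him : ((⟨C, D⟩ : GaussianInt) * ν ^ 4).im = 1 ∨ ((⟨C, D⟩ : GaussianInt) * ν ^ 4).im = -1) :
    ν.norm = 1 := by
  obtain ⟨e, f⟩ := ν
  rw [Zsqrtd.norm_def]
  have hgoal : e * e - -1 * f * f = e ^ 2 + f ^ 2 := by ring
  rw [hgoal]
  rw [mul_comm] at him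
  have habs4 : 5 ≤ |4 * C| := by rw [abs_mul]; norm_num; omega
  rcases hD with rfl | rfl
  · rw [(im_pow_four_mul_slice e f C).1] at him
    refine sq_add_sq_eq_one_of_simplestQuartic h (s := -4 * C) ?_ him
    rwa [neg_mul, abs_neg]
  · rw [(im_pow_four_mul_slice e f C).2, neg_eq_iff_eq_neg, neg_inj, or_comm] at him
    exact sq_add_sq_eq_one_of_simplestQuartic h habs4 him

/-- On the slice `|C| = 1` (`m = 2`) the solutions have `N(ν) ∈ {1, 13}` (conditional on Chen–Voutier
Thm 3 at `s = 4`). [folklore] -/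
theorem norm_of_unit_slice_one (h : SimplestQuarticThueSolutions) {C D : ℤ} (hD : D = 1 ∨ D = -1)
    (hC : C = 1 ∨ C = -1) (ν : GaussianInt)
    (him : ((⟨C, D⟩ : GaussianInt) * ν ^ 4).im = 1 ∨ ((⟨C, D⟩ : GaussianInt) * ν ^ 4).im = -1) :
    ν.norm = 1 ∨ ν.norm = 13 := by
  obtain ⟨e, f⟩ := ν
  rw [Zsqrtd.norm_def]
  have hgoal : e * e - -1 * f * f = e ^ 2 + f ^ 2 := by ring
  rw [hgoal]
  rw [mul_comm] at him
  rcases hD with rfl | rfl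
  · rw [(im_pow_four_mul_slice e f C).1] at him
    refine sq_add_sq_of_simplestQuartic_four h (s := -4 * C) ?_ him
    rcases hC with rfl | rfl <;> norm_num
  · rw [(im_pow_four_mul_slice e f C).2, neg_eq_iff_eq_neg, neg_inj, or_comm] at him
    refine sq_add_sq_of_simplestQuartic_four h (s := 4 * C) ?_ him
    rcases hC with rfl | rfl <;> norm_num

/-- Elements of norm `2` in `ℤ[i]` are `±1 ± i`. [folklore] -/
theorem re_im_of_norm_two {μ : GaussianInt} (hμ : μ.norm = 2) :
    (μ.re = 1 ∨ μ.re = -1) ∧ (μ.im = 1 ∨ μ.im = -1) := by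
  obtain ⟨a, b⟩ := μ
  rw [Zsqrtd.norm_def] at hμ
  simp only at hμ ⊢
  have hab : a * a + b * b = 2 := by linarith
  have ha1 : a ≤ 1 := by nlinarith [mul_self_nonneg b, mul_self_nonneg (a - 2)]
  have ha2 : -1 ≤ a := by nlinarith [mul_self_nonneg b, mul_self_nonneg (a + 2)]
  have hb1 : b ≤ 1 := by nlinarith [mul_self_nonneg a, mul_self_nonneg (b - 2)]
  have hb2 : -1 ≤ b := by nlinarith [mul_self_nonneg a, mul_self_nonneg (b + 2)]
  interval_cases a <;> interval_cases b <;> simp_all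

/-- **Ljunggren's theorem from Chen–Voutier Thm 3** (conditional on the named fact): if
`1 + t² = 2·n⁴` then `n = 1` or `n = 13` (`t = 1`, resp. `t = 239`).  Proof: `t + i = μ·ν⁴` with
`N(μ) = 2`, `N(ν) = n` (`GaussianNormalForm.thueSolution_of_cell`); `μ = ±1 ± i` is the slice
`|C| = 1`, so `(e, ±f)` solves `P_4 = ±1` and `n = e² + f² ∈ {1, 13}`. [folklore] -/
theorem ljunggren_of_simplestQuarticThue
    (h : Literature.NumberTheory.DiophantineGeometry.SimplestQuarticThueSolutions) :
    ∀ t n : ℕ, 1 + t ^ 2 = 2 * n ^ 4 → n = 1 ∨ n = 13 := by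
  intro t n hcell
  obtain ⟨μ, ν, hμ, hν, him, -⟩ := GaussianNormalForm.thueSolution_of_cell hcell
  have hμ2 : μ.norm = 2 := by exact_mod_cast hμ
  obtain ⟨hC, hD⟩ := re_im_of_norm_two hμ2
  have hμeq : μ = (⟨μ.re, μ.im⟩ : GaussianInt) := rfl
  rw [hμeq] at him
  have key := norm_of_unit_slice_one h hD hC ν (Or.inl him)
  rw [hν] at key
  rcases key with h1 | h13
  · left; exact_mod_cast h1
  · right; exact_mod_cast h13

/-! ## Per `m ≥ 3` the cell has at most one point -/

/-- **At most one cell point per `m ≥ 3`** (the named fact `NegPellQuarticAtMostOne`, Chen–Voutier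
Thm 4, in cell coordinates): if `1 + t₁² = m·n₁⁴` and `1 + t₂² = m·n₂⁴` with all entries positive and
`m ≥ 3`, then `(t₁, n₁) = (t₂, n₂)`; and `n²` is the `√m`-coordinate of the least positive solution of
`X² + 1 = mY²`. [folklore] -/
theorem cell_point_unique_of_negPellQuartic (h4 : NegPellQuarticAtMostOne) {m : ℕ} (hm : 3 ≤ m)
    {t₁ n₁ t₂ n₂ : ℕ} (ht₁ : 0 < t₁) (hn₁ : 0 < n₁) (ht₂ : 0 < t₂) (hn₂ : 0 < n₂)
    (h₁ : 1 + t₁ ^ 2 = m * n₁ ^ 4) (h₂ : 1 + t₂ ^ 2 = m * n₂ ^ 4) : t₁ = t₂ ∧ n₁ = n₂ :=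
  (h4 m hm).1 t₁ n₁ t₂ n₂ ht₁ hn₁ ht₂ hn₂ (by rw [add_comm, h₁]) (by rw [add_comm, h₂])

/-- … and the enemy is the fundamental unit: if `1 + t² = m·n⁴` (`m ≥ 3`, `t, n > 0`) then `n² ≤ v` for
every positive solution `(u, v)` of `u² + 1 = m·v²` (Chen–Voutier Thm 4, second clause). [folklore] -/
theorem cell_modulus_sq_le_of_negPellQuartic (h4 : NegPellQuarticAtMostOne) {m : ℕ} (hm : 3 ≤ m)
    {t n : ℕ} (ht : 0 < t) (hn : 0 < n) (hcell : 1 + t ^ 2 = m * n ^ 4) {u v : ℕ} (hv : 0 < v)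
    (huv : u ^ 2 + 1 = m * v ^ 2) : n ^ 2 ≤ v :=
  (h4 m hm).2 t n ht hn (by rw [add_comm, hcell]) u v hv huv

end Summit.ABC.ABC.Theorems.UniformSadicTowerFour.QuarticRootWall
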